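import Mathlib
import Summits.Ventures.HodgeRepro2.Tier7.Line3.Unfolding

/-!
# Tier7/Line3/GeometricSideStab — the class term with a displayed stabiliser = the orbital integral over `S \ H`

Filer: t7-L1-p3 (gen 3, prover-pub-hodge-repro2-t7-L1-p3-g3-0), TARGET line STATUS l. 15141. Lane: SUPPORT for
Line 3's version-(ii) chain (L3-ARGUMENT.md §2 «GEOMETRIC SIDE … `∫_{T_A^γ(F)\T_A(𝔸)×T_B(𝔸)}` … for REGULAR `γ` the
stabiliser is the diagonal centre, the integrand is `Z(𝔸)^Δ`-invariant by the central match (C)»); the stabiliser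
version of `GeometricSide.integral_orbital_eq_setIntegral_tsum_range` (O3) — NOT a line, NOT a device.

WHAT IT SUPPLIES. `H` a group with a left-invariant measure `μ` (for the real objects `H = T_A(𝔸) × T_B(𝔸)`),
`Δ ≤ H` a countable subgroup with a fundamental domain `sΔ` (`Δ = T_A(F) × T_B(F)`), `S ≤ Δ` a subgroup with a
measurable fundamental domain `sS` (`S` = the stabiliser of `γ`, for the real pair the diagonal centre `Z(F)^Δ`),
an «orbit map» `o : H → G` whose fibres on `Δ` are the right cosets of `S` (`o δ = o δ' ↔ δ δ'⁻¹ ∈ S`; for the real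
objects `o(t, t′) = t⁻¹ γ t′` and `G = U(W_A)(𝔸)`), a function `Ψ : H → ℂ` integrable on `sS` and a family
`T : G → H → ℂ` with `T (o δ) h = Ψ (δ h)` for `δ ∈ Δ` (for the real objects `Ψ(t, t′) = f(t⁻¹ γ t′) μ_A(t) conj μ_B(t′)`
and `T g (t, t′) = f(t⁻¹ g t′) μ_A(t) conj μ_B(t′)`; the `S`-invariance of `Ψ` is a consequence). Then

  (O3′) `∫ h in sS, Ψ h ∂μ = ∫ h in sΔ, ∑' x : o '' Δ, T x h ∂μ`

— the class term of the `Δ`-orbit `o '' Δ` (= the double coset `T_A(F) γ T_B(F)`, `GeometricSide` (O5)) in the double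
period of the Poincaré series equals the orbital integral over a fundamental domain of the stabiliser, i.e. over
`S \ H` = `Z(F)^Δ \ (T_A(𝔸) × T_B(𝔸))`. Reading for the real pair (in words): `Ψ` is `Z(𝔸)^Δ`-invariant by (C), so this
is `vol(Z(F)\Z(𝔸))` times the orbital integral modulo the diagonal centre, the `vol · ∏_v O_γ(f_v)` of memo §2 — the
factorisation into local integrals stays with the dictionary. `ae_existsUnique_smul_mem`: a.e. point of `H` has
exactly one `S`-translate in `sS` (from Mathlib's `IsFundamentalDomain`).

PROOF. `∫_{sS} Ψ = ∫_H Ψ·1_{sS}` = (U1 of `Unfolding`) `∫_{sΔ} ∑_{δ ∈ Δ} (Ψ·1_{sS})(δ h)`; for a.e. `h` the series is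
absolutely convergent (U1′), regroup it along the fibres of `o` (`HasSum.tsum_fiberwise`), each fibre is a right
coset `S δ₀ ≃ S`, on which `(Ψ·1_{sS})(σ δ₀ h) = Ψ(δ₀ h)·1_{sS}(σ·(δ₀ h))` and exactly one `σ` contributes.

Nothing about `X`; nothing about the step (P) is claimed.
§8(d) (uses an L-value-free non-vanishing device): NO — double-coset bookkeeping.
-/

namespace Summit.Ventures.HodgeRepro2.Tier7.Line3.GeometricSideStab

open MeasureTheory
open scoped ENNReal Pointwise

variable {H : Type*} [Group H] [MeasurableSpace H] [MeasurableMul H] {μ : Measure H}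
  [μ.IsMulLeftInvariant] {Δ S : Subgroup H} [Countable Δ] [Countable S] {sΔ sS : Set H}

omit [MeasurableMul H] [μ.IsMulLeftInvariant] [Countable Δ] in
/-- For a fundamental domain `sS` of a countable subgroup `S`, a.e. point has EXACTLY ONE `S`-translate in `sS`. -/
theorem ae_existsUnique_smul_mem (hsS : IsFundamentalDomain S sS μ) :
    ∀ᵐ x ∂μ, ∃! σ : S, σ • x ∈ sS := by
  have hdisj : ∀ᵐ x ∂μ, ∀ σ σ' : S, σ • x ∈ sS → σ' • x ∈ sS → σ = σ' := by
    rw [ae_all_iff]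
    intro σ
    rw [ae_all_iff]
    intro σ'
    by_cases hne : σ = σ'
    · exact Filter.Eventually.of_forall (fun _ _ _ => hne)
    · rw [ae_iff]
      refine measure_mono_null (t := (σ⁻¹ • sS) ∩ (σ'⁻¹ • sS)) ?_
        (hsS.aedisjoint (inv_injective.ne hne))
      intro x hx
      obtain ⟨h1, h2⟩ := Classical.not_imp.mp hx
      obtain ⟨h2, _⟩ := Classical.not_imp.mp h2
      refine ⟨?_, ?_⟩
      · rw [Set.mem_smul_set_iff_inv_smul_mem, inv_inv]
        exact h1
      · rw [Set.mem_smul_set_iff_inv_smul_mem, inv_inv]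
        exact h2
  filter_upwards [hsS.ae_covers, hdisj] with x hcov hdis
  obtain ⟨σ, hσ⟩ := hcov
  exact ⟨σ, hσ, fun σ' hσ' => hdis σ' σ hσ' hσ⟩

omit [MeasurableSpace H] [MeasurableMul H] [Countable Δ] [Countable S] in
/-- The `S`-invariance of `Ψ` follows from the fibre description of `o` and `T (o δ) h = Ψ (δ h)`. -/
theorem psi_mul_eq_of_mem (hSΔ : S ≤ Δ) {G : Type*} (o : H → G)
    (ho : ∀ δ ∈ Δ, ∀ δ' ∈ Δ, (o δ = o δ' ↔ δ * δ'⁻¹ ∈ S)) (Ψ : H → ℂ) (T : G → H → ℂ)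
    (hT : ∀ δ ∈ Δ, ∀ h, T (o δ) h = Ψ (δ * h)) {σ : H} (hσ : σ ∈ S) (h : H) :
    Ψ (σ * h) = Ψ h := by
  have h1 : o σ = o 1 := (ho σ (hSΔ hσ) 1 Δ.one_mem).mpr (by simpa using hσ)
  have h2 := hT σ (hSΔ hσ) h
  have h3 := hT 1 Δ.one_mem h
  rw [h1, h3, one_mul] at h2
  exact h2.symm

/-- (O3′) **Class term with a displayed stabiliser = orbital integral over `S \ H`.** Let `sΔ` be a fundamental
domain for the countable subgroup `Δ`, `sS` a measurable fundamental domain for the countable subgroup `S ≤ Δ`,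
`o : H → G` with `o δ = o δ' ↔ δ δ'⁻¹ ∈ S` on `Δ` (the fibres of the orbit map are the right cosets of the
stabiliser), `Ψ` integrable on `sS` and `T (o δ) h = Ψ (δ * h)` for `δ ∈ Δ`. Then
`∫ h in sS, Ψ h ∂μ = ∫ h in sΔ, ∑' x : o '' Δ, T x h ∂μ`. -/
theorem setIntegral_eq_setIntegral_tsum_image (hsΔ : IsFundamentalDomain Δ sΔ μ)
    (hsS : IsFundamentalDomain S sS μ) (hmS : MeasurableSet sS) (hSΔ : S ≤ Δ) {G : Type*}
    (o : H → G) (ho : ∀ δ ∈ Δ, ∀ δ' ∈ Δ, (o δ = o δ' ↔ δ * δ'⁻¹ ∈ S)) (Ψ : H → ℂ)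
    (hΨ : IntegrableOn Ψ sS μ) (T : G → H → ℂ) (hT : ∀ δ ∈ Δ, ∀ h, T (o δ) h = Ψ (δ * h)) :
    ∫ h in sS, Ψ h ∂μ = ∫ h in sΔ, ∑' x : (o '' (Δ : Set H)), T x h ∂μ := by
  classical
  -- the indicator function and its unfolding over `sΔ`
  have hΘint : Integrable (sS.indicator Ψ) μ := hΨ.integrable_indicator hmS
  rw [← integral_indicator hmS, Unfolding.integral_eq_setIntegral_tsum hsΔ _ hΘint]
  apply integral_congr_ae
  have hsum := Unfolding.ae_summable_norm hsΔ (sS.indicator Ψ) hΘint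
  have huniq : ∀ᵐ h ∂(μ.restrict sΔ), ∀ δ : Δ, ∃! σ : S, σ • (δ • h) ∈ sS := by
    apply ae_restrict_of_ae
    rw [ae_all_iff]
    intro δ
    exact (measurePreserving_smul δ μ).quasiMeasurePreserving.ae (ae_existsUnique_smul_mem hsS)
  filter_upwards [hsum, huniq] with h hsum huniq
  -- the class map `q : Δ → o '' Δ`
  let q : Δ → (o '' (Δ : Set H)) := fun δ => ⟨o δ, ⟨δ, δ.2, rfl⟩⟩
  have hS : Summable fun δ : Δ => sS.indicator Ψ (δ • h) := hsum.of_norm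
  rw [← (hS.hasSum.tsum_fiberwise q).tsum_eq]
  apply tsum_congr
  intro x
  obtain ⟨δ₀, hδ₀, hx⟩ := x.2
  -- the fibre of `q` over `x` is the right coset `S δ₀`
  have hfib : ∀ δ : Δ, q δ = x ↔ (δ : H) * (δ₀ : H)⁻¹ ∈ S := by
    intro δ
    rw [Subtype.ext_iff]
    show o δ = x.1 ↔ _
    rw [← hx]
    exact ho δ δ.2 δ₀ hδ₀
  let e : S → (q ⁻¹' {x}) := fun σ =>
    ⟨⟨(σ : H) * δ₀, Δ.mul_mem (hSΔ σ.2) hδ₀⟩, by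
      rw [Set.mem_preimage, Set.mem_singleton_iff, hfib]
      simp⟩
  have he : Function.Bijective e := by
    constructor
    · intro σ σ' hσ
      have : (σ : H) * δ₀ = (σ' : H) * δ₀ :=
        congrArg (fun d : (q ⁻¹' {x}) => ((d : Δ) : H)) hσ
      exact Subtype.ext (mul_right_cancel this)
    · intro d
      have hd := (hfib d).mp d.2
      refine ⟨⟨(d : Δ) * (δ₀ : H)⁻¹, hd⟩, ?_⟩
      apply Subtype.ext
      apply Subtype.ext
      show ((d : Δ) : H) * (δ₀ : H)⁻¹ * δ₀ = (d : Δ)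
      rw [inv_mul_cancel_right]
  rw [← (Equiv.ofBijective e he).tsum_eq]
  show ∑' σ : S, sS.indicator Ψ ((e σ : Δ) • h) = T x h
  -- on the coset, the indicator sum has exactly one term
  have hinv : ∀ σ : S, sS.indicator Ψ ((e σ : Δ) • h) =
      if (σ : H) * ((δ₀ : H) * h) ∈ sS then Ψ ((δ₀ : H) * h) else 0 := by
    intro σ
    have hpt : ((e σ : Δ) • h) = (σ : H) * ((δ₀ : H) * h) := by
      rw [Subgroup.smul_def, smul_eq_mul]
      show (σ : H) * δ₀ * h = _
      rw [mul_assoc]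
    rw [hpt, Set.indicator_apply]
    split_ifs with hmem
    · exact psi_mul_eq_of_mem hSΔ o ho Ψ T hT σ.2 _
    · rfl
  obtain ⟨σ₀, hσ₀, hσ₀u⟩ := huniq ⟨δ₀, hδ₀⟩
  have hσ₀' : (σ₀ : H) * ((δ₀ : H) * h) ∈ sS := by
    simpa [Subgroup.smul_def, smul_eq_mul] using hσ₀
  have hsingle : ∀ σ : S, σ ≠ σ₀ → sS.indicator Ψ ((e σ : Δ) • h) = 0 := by
    intro σ hσ
    rw [hinv, if_neg]
    intro hmem
    apply hσ
    apply hσ₀u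
    simpa [Subgroup.smul_def, smul_eq_mul] using hmem
  rw [tsum_eq_single σ₀ hsingle, hinv, if_pos hσ₀']
  -- the value of the class function
  rw [← hT δ₀ hδ₀ h, hx]

end Summit.Ventures.HodgeRepro2.Tier7.Line3.GeometricSideStab
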